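import Literature.MathematicalPhysics.KineticTheory.HardSphereEulerProofs
import Summits.AtomisticToContinuum.HydrodynamicLimit.Theorems.LocalSecondLaw.Negative.Functional
import HarnessLib

/-!
# Maxwellian entropy minimum in velocity space — tools for stub M `stub_maxwellisation`

Helper for the line `contact-asymmetry-information` of the crux `LocalSecondLaw` (stmt-AtomisticToContinuum-13081;
checked skeleton `Cruxes/LocalSecondLaw/Lines/contact_asymmetry_information.lean`), stub M `stub_maxwellisation`
(also usable by stubs Q `stub_pinnedRepresentation` and B′ `stub_initialMatching` of the same line, and by the
`klMaxwell ≥ 0` bookkeeping of `Literature/MathematicalPhysics/KineticTheory/KineticEntropyBalanceFunctional.lean`).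

WHAT.  The Maxwellisation gap of the line is `∫∫ (Hs(ρ̄, θ̄) − h̄_kin) ∂ₛφ` with
`h̄_kin = b_r ∗ h₁ + c₀ ρ̄ + ρ̄ f_ex(ρ̄σ³)`, `h₁ = ∫ f log f dv`, `c₀ = (3/2)(1 + log 2π)`.  Its integrand has a SIGN:
pointwise in `(s, x)`, `Hs(ρ̄, θ̄) ≤ h(f̄) + c₀ ρ̄ + ρ̄ f_ex(ρ̄σ³)` for every velocity density `f̄(s, x, ·)` of mass `ρ̄`
and kinetic temperature `θ̄` — Gibbs' inequality at the moment-matched Maxwellian (the `f_ex` terms cancel, no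
equation-of-state input).  This file proves that velocity-space fact in the vocabulary of the crux functional
(`Hs` of `Theorems/LocalSecondLaw/Negative/Functional.lean`, `localMaxwellian` of the prelude):

* `log_localMaxwellian_of_pos` — `log M_{ρ,u,θ}(v) = log ρ − (3/2) log(2πθ) − ‖v − u‖²/(2θ)` on `ℝ³`;
* `sub_le_mul_log_sub_mul_log` — pointwise Gibbs `g − m ≤ g log g − g log m` (`g ≥ 0`, `m > 0`);
* `integral_mul_log_localMaxwellian` — `∫ g log M_{ρ,u,θ} = (log ρ − (3/2) log(2πθ)) (∫ g) − (2θ)⁻¹ ∫ ‖v − u‖² g`;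
* `integral_mul_log_localMaxwellian_le` — GIBBS AT A MAXWELLIAN OF EQUAL MASS: `∫ g log M_{ρ,u,θ} ≤ ∫ g log g`
  whenever `g ≥ 0`, `∫ g = ρ > 0`, `θ > 0` (and the three integrability side conditions);
* `integral_norm_sub_sq_mul_pos` — a non-zero velocity density is not concentrated at a point: `0 < ∫ ‖v − u‖² g`;
* `maxwellian_entropy_minimum` — with the temperature about `u`, `θ_u = (3ρ)⁻¹ ∫ ‖v − u‖² g`:
  `ρ log ρ − (3/2) ρ log θ_u − c₀ ρ ≤ ∫ g log g` (for EVERY centre `u`; sharpest at the mean velocity, where `θ_u`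
  is the kinetic temperature);
* `Hs_le_integral_mul_log` — the same in the crux's guarded entropy density:
  `Hs σ ρ θ_u ≤ ∫ g log g + c₀ ρ + ρ f_ex(ρσ³)`;
* `integrable_norm_sub_sq_mul` — the shifted second moment from `∫ ‖v‖² g < ∞`;
* `norm_sub_sq_moment_eq` — `∫ ‖v − u‖² g = ∫ ‖v‖² g − 2⟪∫ g v, u⟫ + ρ‖u‖²`, whence at the mean velocity
  `ū = ρ⁻¹ ∫ g v` the temperature about `ū` is the line's `θ̄ = (2/3)(ē/ρ̄ − ‖m̄‖²/(2ρ̄²))`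
  (`temperature_about_mean_eq`), so `Hs σ ρ̄ θ̄ ≤ h(f̄) + c₀ρ̄ + ρ̄ f_ex(ρ̄σ³)` (`Hs_thetaBar_le_integral_mul_log`);
* `integral_mixture_mul_log_le` — the JENSEN DEFECT of the smearing is non-negative: for a probability kernel `π` (the
  cone `b_r(·, x) dy`) and velocity densities `f y ≥ 0`, `∫ F log F ≤ ∫ (∫ f log f dv) dπ` with `F = ∫ f y dπ(y)` — so,
  with `π = b_r(·,x)dy`, `h(f̄) ≤ b_r ∗ h₁` and altogether `Hs(ρ̄, θ̄) ≤ h̄_kin`: the Maxwellisation-gap integrand of the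
  line is NON-POSITIVE wherever the objects are honest (its two-sided smallness is the stub's content).

References: C. Cercignani, R. Illner, M. Pulvirenti, *The Mathematical Theory of Dilute Gases* (1994), §3.2–3.4
(Maxwellians minimise `H` at fixed mass, momentum, energy); C. Villani, *A review of mathematical topics in
collisional kinetic theory* (2002), Ch. 1 §2.4.
-/

noncomputable section

namespace Summit.AtomisticToContinuum.HydrodynamicLimit.Theorems.LocalSecondLawMaxwellisation

open MeasureTheory
open scoped InnerProductSpace
open Literature.MathematicalPhysics.KineticTheory Literature.Analysis.FluidPDE
open Summit.AtomisticToContinuum.HydrodynamicLimit.Theorems.LocalSecondLawNegative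

/-! ## §1 Scalar facts -/

/-- `log M_{ρ,u,θ}(v) = log ρ − (3/2) log(2πθ) − ‖v − u‖²/(2θ)` on `ℝ³` (`ρ, θ > 0`). [folklore] -/
theorem log_localMaxwellian_of_pos {ρ θ : ℝ} (hρ : 0 < ρ) (hθ : 0 < θ) (u v : V3) :
    Real.log (localMaxwellian ρ θ u v) =
      Real.log ρ - 3 / 2 * Real.log (2 * Real.pi * θ) - ‖v - u‖ ^ 2 / (2 * θ) := by
  unfold localMaxwellian
  have h2 : (0 : ℝ) < 2 * Real.pi * θ := by positivity
  rw [Real.log_mul (mul_pos hρ (Real.rpow_pos_of_pos h2 _)).ne' (Real.exp_pos _).ne',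
    Real.log_mul hρ.ne' (Real.rpow_pos_of_pos h2 _).ne', Real.log_exp, Real.log_rpow h2,
    finrank_euclideanSpace_fin]
  push_cast
  ring

/-- **Pointwise Gibbs inequality**: `g − m ≤ g log g − g log m` for `g ≥ 0`, `m > 0` (i.e. `g log(g/m) ≥ g − m`,
written without the quotient so that the junk `log 0 = 0` only meets `0 · _`). [folklore] -/
theorem sub_le_mul_log_sub_mul_log {g m : ℝ} (hg : 0 ≤ g) (hm : 0 < m) :
    g - m ≤ g * Real.log g - g * Real.log m := by
  rcases hg.eq_or_lt with h0 | hpos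
  · rw [← h0]; simp [hm.le]
  · have h := Real.log_le_sub_one_of_pos (div_pos hm hpos)
    rw [Real.log_div hm.ne' hpos.ne'] at h
    have h2 : g * (Real.log m - Real.log g) ≤ g * (m / g - 1) := mul_le_mul_of_nonneg_left h hg
    have h3 : g * (m / g - 1) = m - g := by field_simp
    linarith [h2, h3]

/-- `M_{ρ,u,θ} = ρ · M_{1,u,θ}`. [folklore] -/
theorem localMaxwellian_eq_mul_one (ρ θ : ℝ) (u : V3) :
    localMaxwellian ρ θ u = fun v => ρ * localMaxwellian 1 θ u v := by
  funext v
  simp only [localMaxwellian, one_mul]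
  ring

/-- `M_{ρ,u,θ}` is integrable on `ℝ³` (`θ > 0`). [folklore] -/
theorem integrable_localMaxwellian_of_pos (ρ : ℝ) {θ : ℝ} (hθ : 0 < θ) (u : V3) :
    Integrable (localMaxwellian ρ θ u) := by
  rw [localMaxwellian_eq_mul_one]
  exact (integrable_localMaxwellian hθ u).const_mul ρ

/-! ## §2 Gibbs' inequality at a Maxwellian of equal mass -/

/-- `∫ g log M_{ρ,u,θ} = (log ρ − (3/2) log(2πθ)) ∫ g − (2θ)⁻¹ ∫ ‖v − u‖² g`. [folklore] -/
theorem integral_mul_log_localMaxwellian {g : V3 → ℝ} {ρ θ : ℝ} (hρ : 0 < ρ) (hθ : 0 < θ) (u : V3)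
    (hg : Integrable g) (hg2 : Integrable fun v => ‖v - u‖ ^ 2 * g v) :
    ∫ v, g v * Real.log (localMaxwellian ρ θ u v) =
      (Real.log ρ - 3 / 2 * Real.log (2 * Real.pi * θ)) * (∫ v, g v) -
        (2 * θ)⁻¹ * ∫ v, ‖v - u‖ ^ 2 * g v := by
  have h : ∀ v, g v * Real.log (localMaxwellian ρ θ u v) =
      (Real.log ρ - 3 / 2 * Real.log (2 * Real.pi * θ)) * g v - (2 * θ)⁻¹ * (‖v - u‖ ^ 2 * g v) := by
    intro v
    rw [log_localMaxwellian_of_pos hρ hθ]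
    field_simp
  have hA : ∫ v, ((Real.log ρ - 3 / 2 * Real.log (2 * Real.pi * θ)) * g v - (2 * θ)⁻¹ * (‖v - u‖ ^ 2 * g v)) =
      (∫ v, (Real.log ρ - 3 / 2 * Real.log (2 * Real.pi * θ)) * g v) - ∫ v, (2 * θ)⁻¹ * (‖v - u‖ ^ 2 * g v) :=
    integral_sub (hg.const_mul _) (hg2.const_mul _)
  simp_rw [h]
  rw [hA, integral_const_mul, integral_const_mul]

/-- `v ↦ g log M_{ρ,u,θ}` is integrable (finite mass and shifted second moment). [folklore] -/
theorem integrable_mul_log_localMaxwellian {g : V3 → ℝ} {ρ θ : ℝ} (hρ : 0 < ρ) (hθ : 0 < θ) (u : V3)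
    (hg : Integrable g) (hg2 : Integrable fun v => ‖v - u‖ ^ 2 * g v) :
    Integrable fun v => g v * Real.log (localMaxwellian ρ θ u v) := by
  have h : (fun v => g v * Real.log (localMaxwellian ρ θ u v)) = fun v =>
      (Real.log ρ - 3 / 2 * Real.log (2 * Real.pi * θ)) * g v - (2 * θ)⁻¹ * (‖v - u‖ ^ 2 * g v) := by
    funext v
    rw [log_localMaxwellian_of_pos hρ hθ]
    field_simp
  rw [h]
  exact (hg.const_mul _).sub (hg2.const_mul _)

/-- **Gibbs' inequality at a Maxwellian of equal mass.**  For a velocity density `g ≥ 0` of mass `∫ g = ρ > 0`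
with `g log g` and `‖v − u‖² g` integrable, and every `θ > 0`: `∫ g log M_{ρ,u,θ} ≤ ∫ g log g`
(integrate `g − M ≤ g log g − g log M`; both sides have mass `ρ`). [folklore] -/
theorem integral_mul_log_localMaxwellian_le {g : V3 → ℝ} {ρ θ : ℝ} (hρ : 0 < ρ) (hθ : 0 < θ) (u : V3)
    (hg0 : ∀ v, 0 ≤ g v) (hg : Integrable g) (hglog : Integrable fun v => g v * Real.log (g v))
    (hg2 : Integrable fun v => ‖v - u‖ ^ 2 * g v) (hmass : ∫ v, g v = ρ) :
    ∫ v, g v * Real.log (localMaxwellian ρ θ u v) ≤ ∫ v, g v * Real.log (g v) := by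
  have hM : Integrable (localMaxwellian ρ θ u) := integrable_localMaxwellian_of_pos ρ hθ u
  have hlogM := integrable_mul_log_localMaxwellian hρ hθ u hg hg2
  have hptw : ∀ v, g v - localMaxwellian ρ θ u v ≤
      g v * Real.log (g v) - g v * Real.log (localMaxwellian ρ θ u v) :=
    fun v => sub_le_mul_log_sub_mul_log (hg0 v) (localMaxwellian_pos hρ hθ u v)
  have h1 : ∫ v, (g v - localMaxwellian ρ θ u v) ≤
      ∫ v, (g v * Real.log (g v) - g v * Real.log (localMaxwellian ρ θ u v)) :=
    integral_mono (hg.sub hM) (hglog.sub hlogM) hptw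
  have h2 : ∫ v, (g v - localMaxwellian ρ θ u v) = (∫ v, g v) - ∫ v, localMaxwellian ρ θ u v :=
    integral_sub hg hM
  have h3 : ∫ v, (g v * Real.log (g v) - g v * Real.log (localMaxwellian ρ θ u v)) =
      (∫ v, g v * Real.log (g v)) - ∫ v, g v * Real.log (localMaxwellian ρ θ u v) :=
    integral_sub hglog hlogM
  rw [h2, h3, hmass, integral_localMaxwellian hθ ρ u, sub_self] at h1
  linarith

/-! ## §3 The entropy minimum at the moment-matched temperature -/

/-- **A non-zero velocity density is not concentrated at a point**: `0 < ∫ ‖v − u‖² g` for `g ≥ 0` integrable with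
`∫ g > 0` (the singleton `{u}` is Lebesgue-null). [folklore] -/
theorem integral_norm_sub_sq_mul_pos {g : V3 → ℝ} (u : V3) (hg0 : ∀ v, 0 ≤ g v)
    (hg2 : Integrable fun v => ‖v - u‖ ^ 2 * g v) (hmass : 0 < ∫ v, g v) :
    0 < ∫ v, ‖v - u‖ ^ 2 * g v := by
  have hnn : 0 ≤ ∫ v, ‖v - u‖ ^ 2 * g v := integral_nonneg fun v => mul_nonneg (sq_nonneg _) (hg0 v)
  rcases hnn.eq_or_lt with h0 | hpos
  · exfalso
    have hae : (fun v => ‖v - u‖ ^ 2 * g v) =ᵐ[volume] 0 :=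
      (integral_eq_zero_iff_of_nonneg (fun v => mul_nonneg (sq_nonneg _) (hg0 v)) hg2).1 h0.symm
    have hu : ∀ᵐ v ∂(volume : Measure V3), v ≠ u := by
      have : (volume : Measure V3) {u} = 0 := measure_singleton u
      filter_upwards [measure_eq_zero_iff_ae_notMem.1 this] with v hv
      simpa using hv
    have hg_ae : g =ᵐ[volume] 0 := by
      filter_upwards [hae, hu] with v hv hvu
      have hn : ‖v - u‖ ^ 2 ≠ 0 := by
        have : 0 < ‖v - u‖ := norm_pos_iff.2 (sub_ne_zero.2 hvu)
        positivity
      have hv' : ‖v - u‖ ^ 2 * g v = 0 := hv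
      rcases mul_eq_zero.1 hv' with h | h
      · exact absurd h hn
      · exact h
    have : ∫ v, g v = 0 := by rw [integral_congr_ae hg_ae]; simp
    linarith
  · exact hpos

/-- **The Maxwellian entropy minimum.**  For a velocity density `g ≥ 0` on `ℝ³` of mass `ρ = ∫ g > 0` with `g log g`
and `‖v − u‖² g` integrable, and the temperature about the centre `u`, `θ_u = (3ρ)⁻¹ ∫ ‖v − u‖² g`:
`ρ log ρ − (3/2) ρ log θ_u − (3/2)(1 + log 2π) ρ ≤ ∫ g log g` — the kinetic entropy of `M_{ρ,u,θ_u}`, i.e. Gibbs at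
`θ = θ_u`; valid for EVERY `u`, sharpest at the mean velocity. [folklore] -/
theorem maxwellian_entropy_minimum {g : V3 → ℝ} (u : V3) (hg0 : ∀ v, 0 ≤ g v) (hg : Integrable g)
    (hglog : Integrable fun v => g v * Real.log (g v)) (hg2 : Integrable fun v => ‖v - u‖ ^ 2 * g v)
    (hmass : 0 < ∫ v, g v) :
    (∫ v, g v) * Real.log (∫ v, g v) -
        3 / 2 * (∫ v, g v) * Real.log ((3 * ∫ v, g v)⁻¹ * ∫ v, ‖v - u‖ ^ 2 * g v) -
        3 / 2 * (1 + Real.log (2 * Real.pi)) * ∫ v, g v ≤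
      ∫ v, g v * Real.log (g v) := by
  have hS : 0 < ∫ v, ‖v - u‖ ^ 2 * g v := integral_norm_sub_sq_mul_pos u hg0 hg2 hmass
  have hθ : 0 < (3 * ∫ v, g v)⁻¹ * ∫ v, ‖v - u‖ ^ 2 * g v := by positivity
  have hG := integral_mul_log_localMaxwellian_le hmass hθ u hg0 hg hglog hg2 rfl
  rw [integral_mul_log_localMaxwellian hmass hθ u hg hg2] at hG
  set ρ : ℝ := ∫ v, g v with hρdef
  set S : ℝ := ∫ v, ‖v - u‖ ^ 2 * g v with hSdef
  set θ : ℝ := (3 * ρ)⁻¹ * S with hθdef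
  have hlog2 : Real.log (2 * Real.pi * θ) = Real.log (2 * Real.pi) + Real.log θ :=
    Real.log_mul (by positivity) hθ.ne'
  have hq : (2 * θ)⁻¹ * S = 3 / 2 * ρ := by
    rw [hθdef]
    field_simp
  rw [hlog2, hq] at hG
  have : ρ * Real.log ρ - 3 / 2 * ρ * Real.log θ - 3 / 2 * (1 + Real.log (2 * Real.pi)) * ρ =
      (Real.log ρ - 3 / 2 * (Real.log (2 * Real.pi) + Real.log θ)) * ρ - 3 / 2 * ρ := by ring
  rw [this]
  exact hG

/-- **The crux's guarded entropy density is below the kinetic entropy plus the Résibois comparison terms**: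
`Hs σ ρ θ_u ≤ ∫ g log g + c₀ ρ + ρ f_ex(ρσ³)`, `c₀ = (3/2)(1 + log 2π)`, `θ_u = (3ρ)⁻¹ ∫ ‖v − u‖² g` — the
pointwise sign `Hs(ρ̄, θ̄) − h_kin ≤ 0` of the Maxwellisation-gap integrand BEFORE the cone smearing (the `f_ex` terms
cancel identically). [folklore] -/
theorem Hs_le_integral_mul_log (σ : ℝ) {g : V3 → ℝ} (u : V3) (hg0 : ∀ v, 0 ≤ g v) (hg : Integrable g)
    (hglog : Integrable fun v => g v * Real.log (g v)) (hg2 : Integrable fun v => ‖v - u‖ ^ 2 * g v)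
    (hmass : 0 < ∫ v, g v) :
    Hs σ (∫ v, g v) ((3 * ∫ v, g v)⁻¹ * ∫ v, ‖v - u‖ ^ 2 * g v) ≤
      (∫ v, g v * Real.log (g v)) + 3 / 2 * (1 + Real.log (2 * Real.pi)) * (∫ v, g v) +
        (∫ v, g v) * hsExcessFreeEnergy ((∫ v, g v) * σ ^ 3) := by
  have hθ : 0 < (3 * ∫ v, g v)⁻¹ * ∫ v, ‖v - u‖ ^ 2 * g v :=
    mul_pos (by positivity) (integral_norm_sub_sq_mul_pos u hg0 hg2 hmass)
  have hmin := maxwellian_entropy_minimum u hg0 hg hglog hg2 hmass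
  unfold Hs
  rw [if_pos ⟨hmass, hθ⟩]
  nlinarith [hmin]

/-! ## §4 Second moments: from `∫ ‖v‖² g` to the temperature about the mean velocity -/

/-- The shifted second moment `‖v − u‖² g` is integrable once `g` and `‖v‖² g` are. [folklore] -/
theorem integrable_norm_sub_sq_mul {g : V3 → ℝ} (u : V3) (hg : Integrable g)
    (hg2 : Integrable fun v => ‖v‖ ^ 2 * g v) : Integrable fun v => ‖v - u‖ ^ 2 * g v := by
  have hmeas : AEStronglyMeasurable (fun v => ‖v - u‖ ^ 2 * g v) volume :=
    ((continuous_norm.comp (continuous_id.sub continuous_const)).pow 2).aestronglyMeasurable.mul hg.1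
  refine Integrable.mono' ((hg2.norm.const_mul 2).add (hg.norm.const_mul (2 * ‖u‖ ^ 2))) hmeas
    (Filter.Eventually.of_forall fun v => ?_)
  have h1 : ‖v - u‖ ^ 2 ≤ 2 * ‖v‖ ^ 2 + 2 * ‖u‖ ^ 2 := by
    have h' : ‖v - u‖ ≤ ‖v‖ + ‖u‖ := norm_sub_le v u
    nlinarith [sq_nonneg (‖v‖ - ‖u‖), norm_nonneg (v - u), norm_nonneg v, norm_nonneg u]
  have e1 : ‖‖v - u‖ ^ 2 * g v‖ = ‖v - u‖ ^ 2 * |g v| := by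
    rw [Real.norm_eq_abs, abs_mul, abs_of_nonneg (sq_nonneg ‖v - u‖)]
  have e2 : ‖‖v‖ ^ 2 * g v‖ = ‖v‖ ^ 2 * |g v| := by
    rw [Real.norm_eq_abs, abs_mul, abs_of_nonneg (sq_nonneg ‖v‖)]
  have e3 : ‖g v‖ = |g v| := Real.norm_eq_abs _
  simp only [Pi.add_apply]
  rw [e1, e2, e3]
  nlinarith [mul_le_mul_of_nonneg_right h1 (abs_nonneg (g v))]

/-- `v ↦ g(v) • v` is integrable once `g` and `‖v‖² g` are (`‖v‖ ≤ 1 + ‖v‖²`). [folklore] -/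
theorem integrable_smul_id {g : V3 → ℝ} (hg : Integrable g) (hg2 : Integrable fun v => ‖v‖ ^ 2 * g v) :
    Integrable fun v => g v • v := by
  have hmeas : AEStronglyMeasurable (fun v => g v • v) volume :=
    hg.1.smul continuous_id.aestronglyMeasurable
  refine Integrable.mono' (hg.norm.add hg2.norm) hmeas (Filter.Eventually.of_forall fun v => ?_)
  have hv : ‖v‖ ≤ 1 + ‖v‖ ^ 2 := by nlinarith [norm_nonneg v, sq_nonneg (‖v‖ - 1)]
  have e1 : ‖g v • v‖ = |g v| * ‖v‖ := by rw [norm_smul, Real.norm_eq_abs]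
  have e2 : ‖‖v‖ ^ 2 * g v‖ = ‖v‖ ^ 2 * |g v| := by
    rw [Real.norm_eq_abs, abs_mul, abs_of_nonneg (sq_nonneg ‖v‖)]
  have e3 : ‖g v‖ = |g v| := Real.norm_eq_abs _
  simp only [Pi.add_apply]
  rw [e1, e2, e3]
  nlinarith [mul_le_mul_of_nonneg_left hv (abs_nonneg (g v))]

/-- `v ↦ ⟪u, v⟫ g(v)` is integrable once `g` and `‖v‖² g` are. [folklore] -/
theorem integrable_inner_mul {g : V3 → ℝ} (u : V3) (hg : Integrable g)
    (hg2 : Integrable fun v => ‖v‖ ^ 2 * g v) : Integrable fun v => ⟪u, v⟫_ℝ * g v := by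
  have h := (integrable_smul_id hg hg2).const_inner (𝕜 := ℝ) u
  refine h.congr (Filter.Eventually.of_forall fun v => ?_)
  change ⟪u, g v • v⟫_ℝ = ⟪u, v⟫_ℝ * g v
  rw [real_inner_smul_right]
  ring

/-- **Expansion of the shifted second moment**: `∫ ‖v − u‖² g = ∫ ‖v‖² g − 2⟪u, ∫ g v⟫ + ‖u‖² ∫ g`. [folklore] -/
theorem norm_sub_sq_moment_eq {g : V3 → ℝ} (u : V3) (hg : Integrable g)
    (hg2 : Integrable fun v => ‖v‖ ^ 2 * g v) :
    ∫ v, ‖v - u‖ ^ 2 * g v =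
      (∫ v, ‖v‖ ^ 2 * g v) - 2 * ⟪u, ∫ v, g v • v⟫_ℝ + ‖u‖ ^ 2 * ∫ v, g v := by
  have hsmul := integrable_smul_id hg hg2
  have hinner := integrable_inner_mul u hg hg2
  have hpt : ∀ v, ‖v - u‖ ^ 2 * g v = ‖v‖ ^ 2 * g v - 2 * (⟪u, v⟫_ℝ * g v) + ‖u‖ ^ 2 * g v := by
    intro v
    rw [@norm_sub_sq_real, real_inner_comm]
    ring
  simp_rw [hpt]
  have i1 : ∫ v, (‖v‖ ^ 2 * g v - 2 * (⟪u, v⟫_ℝ * g v) + ‖u‖ ^ 2 * g v) =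
      (∫ v, (‖v‖ ^ 2 * g v - 2 * (⟪u, v⟫_ℝ * g v))) + ∫ v, ‖u‖ ^ 2 * g v :=
    integral_add (hg2.sub (hinner.const_mul 2)) (hg.const_mul _)
  have i2 : ∫ v, (‖v‖ ^ 2 * g v - 2 * (⟪u, v⟫_ℝ * g v)) =
      (∫ v, ‖v‖ ^ 2 * g v) - ∫ v, 2 * (⟪u, v⟫_ℝ * g v) :=
    integral_sub hg2 (hinner.const_mul 2)
  have i3 : ∫ v, ⟪u, v⟫_ℝ * g v = ⟪u, ∫ v, g v • v⟫_ℝ := by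
    rw [← integral_inner (𝕜 := ℝ) hsmul u]
    refine integral_congr_ae (Filter.Eventually.of_forall fun v => ?_)
    change ⟪u, v⟫_ℝ * g v = ⟪u, g v • v⟫_ℝ
    rw [real_inner_smul_right]
    ring
  rw [i1, i2, integral_const_mul, integral_const_mul, i3]

/-- **The temperature about the mean velocity is the line's `θ̄`.**  With `ρ = ∫ g > 0`, `m = ∫ g v`, `e = ∫ ‖v‖² g / 2`
and `ū = ρ⁻¹ m`: `(3ρ)⁻¹ ∫ ‖v − ū‖² g = (2/3)(e/ρ − ‖m‖²/(2ρ²))` — verbatim the formula of `thetaBar`/`thetaC`.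
[folklore] -/
theorem temperature_about_mean_eq {g : V3 → ℝ} (hg : Integrable g) (hg2 : Integrable fun v => ‖v‖ ^ 2 * g v)
    (hmass : 0 < ∫ v, g v) :
    (3 * ∫ v, g v)⁻¹ * ∫ v, ‖v - (∫ v, g v)⁻¹ • ∫ v, g v • v‖ ^ 2 * g v =
      2 / 3 * ((∫ v, ‖v‖ ^ 2 / 2 * g v) / (∫ v, g v) -
        ‖∫ v, g v • v‖ ^ 2 / (2 * (∫ v, g v) ^ 2)) := by
  rw [norm_sub_sq_moment_eq ((∫ v, g v)⁻¹ • ∫ v, g v • v) hg hg2]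
  set ρ : ℝ := ∫ v, g v with hρ
  set m : V3 := ∫ v, g v • v with hm
  have he : ∫ v, ‖v‖ ^ 2 / 2 * g v = (∫ v, ‖v‖ ^ 2 * g v) / 2 := by
    rw [← integral_div]
    congr 1; funext v; ring
  rw [he, real_inner_smul_left, real_inner_self_eq_norm_sq, norm_smul, Real.norm_eq_abs,
    abs_of_pos (inv_pos.2 hmass)]
  field_simp
  ring

/-- **The sign of the Maxwellisation-gap integrand before smearing**, in the line's variables (registered sub-goal of
stub M `stub_maxwellisation`, line `contact-asymmetry-information`, crux stmt-AtomisticToContinuum-13081): for a velocity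
density `g ≥ 0` of mass `ρ̄ = ∫ g > 0` with finite entropy and second moment, momentum `m̄ = ∫ g v`, energy
`ē = ∫ ‖v‖² g / 2` and `θ̄ = (2/3)(ē/ρ̄ − ‖m̄‖²/(2ρ̄²))` (verbatim the line's `thetaBar`):
`Hs σ ρ̄ θ̄ ≤ ∫ g log g + c₀ ρ̄ + ρ̄ f_ex(ρ̄σ³)`, `c₀ = (3/2)(1 + log 2π)`. [folklore] -/
theorem Hs_thetaBar_le_integral_mul_log : ∀ (σ : ℝ) (g : V3 → ℝ), (∀ v, 0 ≤ g v) → MeasureTheory.Integrable g → MeasureTheory.Integrable (fun v => g v * Real.log (g v)) → MeasureTheory.Integrable (fun v => ‖v‖ ^ 2 * g v) → 0 < ∫ v, g v → Hs σ (∫ v, g v) (2 / 3 * ((∫ v, ‖v‖ ^ 2 / 2 * g v) / (∫ v, g v) - ‖∫ v, g v • v‖ ^ 2 / (2 * (∫ v, g v) ^ 2))) ≤ (∫ v, g v * Real.log (g v)) + 3 / 2 * (1 + Real.log (2 * Real.pi)) * (∫ v, g v) + (∫ v, g v) * hsExcessFreeEnergy ((∫ v, g v) * σ ^ 3) := by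
  intro σ g hg0 hg hglog hg2 hmass
  rw [← temperature_about_mean_eq hg hg2 hmass]
  exact Hs_le_integral_mul_log σ _ hg0 hg hglog (integrable_norm_sub_sq_mul _ hg hg2) hmass

/-! ## §5 The Jensen defect of the smearing is non-negative -/

/-- **Jensen for `t log t` under a probability kernel** (the cone smearing `b_r ∗ h₁ ≥ h(b_r ∗ₓ f)` of the line, with
`π = b_r(·, x) dy`, a probability measure by `integral_cone_eq_one`): for a family `f y (·) ≥ 0` of velocity densities,
jointly integrable together with `f log f` against `π ⊗ dv`, the kinetic entropy of the mixture `F = ∫ f y dπ(y)` is at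
most the mixture of the kinetic entropies, `∫ F log F dv ≤ ∫ (∫ f log f dv) dπ`.  (Pointwise in `v`: Mathlib's Jensen
`ConvexOn.map_integral_le` for `Real.convexOn_mul_log`; then Fubini.) [folklore] -/
theorem integral_mixture_mul_log_le {Y : Type*} [MeasurableSpace Y] (π : Measure Y) [IsProbabilityMeasure π]
    {f : Y → V3 → ℝ} (hf0 : ∀ y v, 0 ≤ f y v)
    (hf : Integrable (Function.uncurry f) (π.prod volume))
    (hflog : Integrable (fun p : Y × V3 => f p.1 p.2 * Real.log (f p.1 p.2)) (π.prod volume))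
    (hF : Integrable fun v => (∫ y, f y v ∂π) * Real.log (∫ y, f y v ∂π)) :
    ∫ v, (∫ y, f y v ∂π) * Real.log (∫ y, f y v ∂π) ≤ ∫ y, (∫ v, f y v * Real.log (f y v)) ∂π := by
  -- slice integrability for a.e. velocity (Fubini)
  have h1 : ∀ᵐ v ∂(volume : Measure V3), Integrable (fun y => f y v) π := hf.prod_left_ae
  have h2 : ∀ᵐ v ∂(volume : Measure V3), Integrable (fun y => f y v * Real.log (f y v)) π :=
    hflog.prod_left_ae
  -- pointwise Jensen for the convex `t ↦ t log t` on `[0, ∞)` under the probability measure `π`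
  have hJ : ∀ᵐ v ∂(volume : Measure V3),
      (∫ y, f y v ∂π) * Real.log (∫ y, f y v ∂π) ≤ ∫ y, f y v * Real.log (f y v) ∂π := by
    filter_upwards [h1, h2] with v hv1 hv2
    exact Real.convexOn_mul_log.map_integral_le Real.continuous_mul_log.continuousOn isClosed_Ici
      (ae_of_all _ fun y => Set.mem_Ici.2 (hf0 y v)) hv1 hv2
  -- integrate in `v` and swap the order of integration
  have hG : Integrable (fun v => ∫ y, f y v * Real.log (f y v) ∂π) := hflog.integral_prod_right
  calc ∫ v, (∫ y, f y v ∂π) * Real.log (∫ y, f y v ∂π)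
      ≤ ∫ v, ∫ y, f y v * Real.log (f y v) ∂π := integral_mono_ae hF hG hJ
    _ = ∫ y, (∫ v, f y v * Real.log (f y v)) ∂π :=
        (integral_integral_swap (f := fun y v => f y v * Real.log (f y v)) hflog).symm

end Summit.AtomisticToContinuum.HydrodynamicLimit.Theorems.LocalSecondLawMaxwellisation

end
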